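import Summits.ResolutionOfSingularities.ResolutionOfSingularities.Theorems.HilbertSamuelEliminationCampaignW42ToricMarkedLambda

/-!
# [OURS · L1 W4.2] Toric marked monomial objects in dimension 3 — brick 5B (part 1): LINK DATA OF THE TWO MOVES of procedure Q

[OURS · L1 W4.2 · seat res-L1-s42-pv-2 gen 5] Memo `L/res-L1-s42-pv-2/CALIBRATION-W42-O2-v4.md` §3 (F4)/(K2).  For a corner `C` containing the
ray `k` at which its potential `Λ` is read (brick 5A): (Q1) blowing up the 2-face `{k, b}` of full residual order TRANSLATES the configuration of
the coefficient object `𝒞_k` by `(−θs·L, 0)` — the link potential `linkT` of the child keeping `k` is unchanged and its link minimum sum `psum2`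
drops by exactly `θs·L` (`link_data_curve_move`); (Q2) blowing up the corner itself replaces the configuration, in the two children keeping `k`,
by its images under the two child maps `(x, x+y−θs·L)` and `(x+y−θs·L, y)` of the polyhedra game (`link_data_point_move`), to which the dim-2 step
lemmas of brick 4A apply.  Plus congruence/translation lemmas for `T` and `β₂`.  NOT a statement of the manuscript under review nor of Blanco /
Encinas–Villamayor.  AI work, weaker than expert review.  Pure proofs, no `sorry`, no new axiom.
-/

set_option linter.dupNamespace false -- mandated namespace of this single-conjunct summit

namespace Summit.ResolutionOfSingularities.ResolutionOfSingularities.Theorems.CampaignW42.Toric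

open Finset

namespace PairPot

variable {γ : Type}

/-- `T` only depends on the values of the coordinates on `G`. -/
theorem T_congr (G : Finset γ) {x x' y y' : γ → ℤ} (hx : ∀ g ∈ G, x g = x' g) (hy : ∀ g ∈ G, y g = y' g) :
    T G x y = T G x' y' := by
  unfold T term
  refine Finset.sum_congr rfl (fun g hg => Finset.sum_congr rfl (fun g' hg' => ?_))
  rw [hx g hg, hx g' hg', hy g hg, hy g' hg']

end PairPot

namespace TState

variable {ι : Type} [Fintype ι] [Nonempty ι] [DecidableEq ι]

/-- `β₂` only depends on the values of the scaled exponents on `G2` (congruence). -/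
theorem bmin2_congr {m : ℕ} {s s' : TState ι} {θs L : ℤ} {k k' r r' : ℕ} (hG : s'.G2 m θs k' = s.G2 m θs k)
    (hE : ∀ g ∈ s.G2 m θs k, s'.E2 m θs L k' r' g = s.E2 m θs L k r g) :
    s'.bmin2 m θs L k' r' = s.bmin2 m θs L k r := by
  unfold bmin2
  by_cases hne : (s.G2 m θs k).Nonempty
  · have hne' : (s'.G2 m θs k').Nonempty := by rw [hG]; exact hne
    rw [dif_pos hne', dif_pos hne]
    apply le_antisymm
    · obtain ⟨g, hg, hgeq⟩ := Finset.exists_mem_eq_inf' hne (s.E2 m θs L k r)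
      rw [hgeq, ← hE g hg]; exact Finset.inf'_le _ (by rw [hG]; exact hg)
    · obtain ⟨g, hg, hgeq⟩ := Finset.exists_mem_eq_inf' hne' (s'.E2 m θs L k' r')
      have hg' : g ∈ s.G2 m θs k := by rw [← hG]; exact hg
      rw [hgeq, hE g hg']; exact Finset.inf'_le _ hg'
  · have hne' : ¬ (s'.G2 m θs k').Nonempty := by rw [hG]; exact hne
    rw [dif_neg hne', dif_neg hne]

/-- `β₂` of a translated link ray: if every scaled exponent drops by `c`, so does the minimum. -/
theorem bmin2_translate {m : ℕ} {s s' : TState ι} {θs L : ℤ} {k k' r r' : ℕ} {c : ℤ} (hG : s'.G2 m θs k' = s.G2 m θs k)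
    (hE : ∀ g ∈ s.G2 m θs k, s'.E2 m θs L k' r' g = s.E2 m θs L k r g - c) (hne : (s.G2 m θs k).Nonempty) :
    s'.bmin2 m θs L k' r' = s.bmin2 m θs L k r - c := by
  unfold bmin2
  have hne' : (s'.G2 m θs k').Nonempty := by rw [hG]; exact hne
  rw [dif_pos hne', dif_pos hne]
  apply le_antisymm
  · obtain ⟨g, hg, hgeq⟩ := Finset.exists_mem_eq_inf' hne (s.E2 m θs L k r)
    rw [hgeq, ← hE g hg]; exact Finset.inf'_le _ (by rw [hG]; exact hg)
  · obtain ⟨g, hg, hgeq⟩ := Finset.exists_mem_eq_inf' hne' (s'.E2 m θs L k' r')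
    have hg' : g ∈ s.G2 m θs k := by rw [← hG]; exact hg
    rw [hgeq, hE g hg']
    have := Finset.inf'_le (s.E2 m θs L k r) hg'
    omega

/-- **(Q1) CURVE MOVE, link data.**  Blow up the admissible... the 2-face `R = {k, b}` of full residual order `θs` inside the corner
`C = {k, b, j}`.  In the child `D = (C ∖ b) ∪ {ρ}` read at the same ray `k`: the link potential is unchanged and the link minimum sum drops by
exactly `θs·L` (translation of the configuration of `𝒞_k` by `(−θs·L, 0)`). -/
theorem link_data_curve_move {m : ℕ} {s : TState ι} (hs : s.Nonneg) (hwf : s.WF) {θs L : ℤ} (hθ : 0 < θs) (hL : CommonMult m θs L)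
    {k b j : ℕ} (hkb : k ≠ b) (hkj : k ≠ j) (hbj : b ≠ j) {C : Finset ℕ} (hC : C ∈ s.cones) (hCe : C = {k, b, j})
    (hR : s.thetaR {k, b} = θs) :
    (s.move m {k, b}).linkT m θs L k (insert s.next (C.erase b)) = s.linkT m θs L k C ∧
    (s.move m {k, b}).psum2 m θs L k (insert s.next (C.erase b)) = s.psum2 m θs L k C - θs * L := by
  have hnC : s.next ∉ C := hwf.next_notMem hC
  have hkn : k ≠ s.next := fun h => hnC (by rw [hCe, ← h]; simp)
  have hjn : j ≠ s.next := fun h => hnC (by rw [hCe, ← h]; simp)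
  have hG : (s.move m {k, b}).G2 m θs k = s.G2 m θs k := G2_move hkn
  have hEj : ∀ g ∈ s.G2 m θs k, (s.move m {k, b}).E2 m θs L k j g = s.E2 m θs L k j g :=
    fun g _ => E2_move_of_ne hkn hjn g
  have hEn : ∀ g ∈ s.G2 m θs k, (s.move m {k, b}).E2 m θs L k s.next g = s.E2 m θs L k b g - θs * L := by
    intro g hg
    rw [E2_move_next hs hkn (by simp) hR hL hg]
    have : ({k, b} : Finset ℕ).erase k = {b} := by
      rw [Finset.erase_insert_eq_erase, Finset.erase_eq_of_notMem (by simpa using hkb)]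
    rw [this, Finset.sum_singleton]
  -- the two link faces
  have hCk : C.erase k = {b, j} := by
    rw [hCe, Finset.erase_insert_eq_erase, Finset.erase_eq_of_notMem]
    simp [hkb, hkj]
  have hDk : (insert s.next (C.erase b)).erase k = {s.next, j} := by
    rw [Finset.erase_insert_of_ne hkn.symm, hCe]
    congr 1
    ext r
    simp only [Finset.mem_erase, Finset.mem_insert, Finset.mem_singleton]
    constructor
    · rintro ⟨h1, h2, rfl | rfl | rfl⟩
      · exact absurd rfl h1
      · exact absurd rfl h2
      · rfl
    · rintro rfl; exact ⟨hkj.symm, hbj.symm, Or.inr (Or.inr rfl)⟩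
  constructor
  · rw [linkT_eq hjn.symm hDk, linkT_eq hbj hCk, hG]
    rw [PairPot.T_congr _ hEn hEj]
    exact PairPot.T_translate_left _ _ _ _
  · unfold psum2
    rw [hDk, hCk, Finset.sum_pair hjn.symm, Finset.sum_pair hbj]
    rw [bmin2_translate hG hEn (s.G2_nonempty m hθ k), bmin2_congr hG hEj]
    ring


/-- **(Q2) POINT MOVE, link data.**  Blow up the corner `C = {k, i, j}` itself (full residual order `θs`).  Read at the ray `k`, the two
children keeping `k` carry the configurations of `𝒞_k` obtained by the two child maps of the polyhedra game:
`D_j = (C ∖ j) ∪ {ρ}` ↦ `(x, x + y − θs·L)` and `D_i = (C ∖ i) ∪ {ρ}` ↦ `(x + y − θs·L, y)` where `x = E2 i`, `y = E2 j`. -/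
theorem link_data_point_move {m : ℕ} {s : TState ι} (hs : s.Nonneg) (hwf : s.WF) {θs L : ℤ} (hL : CommonMult m θs L)
    {k i j : ℕ} (hki : k ≠ i) (hkj : k ≠ j) (hij : i ≠ j) {C : Finset ℕ} (hC : C ∈ s.cones) (hCe : C = {k, i, j})
    (hR : s.thetaR C = θs) :
    (s.move m C).linkT m θs L k (insert s.next (C.erase j)) =
        PairPot.T (s.G2 m θs k) (s.E2 m θs L k i) (fun g => s.E2 m θs L k i g + s.E2 m θs L k j g - θs * L) ∧
    (s.move m C).linkT m θs L k (insert s.next (C.erase i)) =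
        PairPot.T (s.G2 m θs k) (fun g => s.E2 m θs L k i g + s.E2 m θs L k j g - θs * L) (s.E2 m θs L k j) ∧
    (s.move m C).G2 m θs k = s.G2 m θs k ∧
    (∀ g ∈ s.G2 m θs k, (s.move m C).E2 m θs L k s.next g = s.E2 m θs L k i g + s.E2 m θs L k j g - θs * L) ∧
    (∀ g ∈ s.G2 m θs k, (s.move m C).E2 m θs L k i g = s.E2 m θs L k i g) ∧
    (∀ g ∈ s.G2 m θs k, (s.move m C).E2 m θs L k j g = s.E2 m θs L k j g) := by
  have hnC : s.next ∉ C := hwf.next_notMem hC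
  have hkn : k ≠ s.next := fun h => hnC (by rw [hCe, ← h]; simp)
  have hin : i ≠ s.next := fun h => hnC (by rw [hCe, ← h]; simp)
  have hjn : j ≠ s.next := fun h => hnC (by rw [hCe, ← h]; simp)
  have hG : (s.move m C).G2 m θs k = s.G2 m θs k := G2_move hkn
  have hEi : ∀ g ∈ s.G2 m θs k, (s.move m C).E2 m θs L k i g = s.E2 m θs L k i g := fun g _ => E2_move_of_ne hkn hin g
  have hEj : ∀ g ∈ s.G2 m θs k, (s.move m C).E2 m θs L k j g = s.E2 m θs L k j g := fun g _ => E2_move_of_ne hkn hjn g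
  have hEn : ∀ g ∈ s.G2 m θs k,
      (s.move m C).E2 m θs L k s.next g = s.E2 m θs L k i g + s.E2 m θs L k j g - θs * L := by
    intro g hg
    have hkC : k ∈ C := by rw [hCe]; simp
    rw [E2_move_next hs hkn hkC hR hL hg]
    have : C.erase k = {i, j} := by
      rw [hCe, Finset.erase_insert_eq_erase, Finset.erase_eq_of_notMem]; simp [hki, hkj]
    rw [this, Finset.sum_pair hij]
  have hDj : (insert s.next (C.erase j)).erase k = {i, s.next} := by
    rw [Finset.erase_insert_of_ne hkn.symm, hCe]
    ext r
    simp only [Finset.mem_erase, Finset.mem_insert, Finset.mem_singleton]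
    omega
  have hDi : (insert s.next (C.erase i)).erase k = {s.next, j} := by
    rw [Finset.erase_insert_of_ne hkn.symm, hCe]
    ext r
    simp only [Finset.mem_erase, Finset.mem_insert, Finset.mem_singleton]
    omega
  refine ⟨?_, ?_, hG, hEn, hEi, hEj⟩
  · rw [linkT_eq hin hDj, hG]
    exact PairPot.T_congr _ hEi hEn
  · rw [linkT_eq hjn.symm hDi, hG]
    exact PairPot.T_congr _ hEn hEj

end TState

end Summit.ResolutionOfSingularities.ResolutionOfSingularities.Theorems.CampaignW42.Toric
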